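import Summits.RiemannHypothesis.RiemannHypothesis.Theorems.UniversalFactorMediumHighErr
import Summits.RiemannHypothesis.RiemannHypothesis.Theorems.UniversalFactorMediumHighCell
import Summits.RiemannHypothesis.RiemannHypothesis.Theorems.UniversalFactorMediumHighSideP
import Summits.RiemannHypothesis.RiemannHypothesis.Theorems.UniversalFactorMediumHighSideQ
import Summits.RiemannHypothesis.RiemannHypothesis.Theorems.UniversalFactorMediumHighH0neg
import Summits.RiemannHypothesis.RiemannHypothesis.Theorems.UniversalFactorMediumCover

/-!
# RiemannHypothesis / UniversalFactor — `MediumKernelNoGo`, high window: soundness of the box and cover checks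

Route `RiemannHypothesis/UniversalFactor`, crux `MediumKernelNoGo` (stmt-RiemannHypothesis-2577), line
`one-sided-average-sign-test`, stub `stub_highWindow`.  `hiSide_core` combines the cell estimate
(`stub_highCell`, `κ = ∓2a`), the identity `Re Σ_j W_j F_κ(½+it_j) = Σ_j W_j e^{−2a d_j} Re F_0(½+it_j)`
(`hiCell_re_sum`), the interval-weight enclosure (`hiSideSum_mem`) and the error bounds
(`hiSideErr_sound`) into `Σ_c ∫_cell g_κ ≥ −K₀ (hi/S + e)`; `hiBoxCheck_sound` adds the
decompositions `stub_highSideP/Q`, the tails `stub_highTailP/Q` (`hiTails_sound`) and the sign of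
`H_0(2t₀)` (`hCheck`, `stub_highH0neg`): a passing box gives the dip certificate
`H_0(x₀) < 0 < P_a(x₀), Q_a(x₀)` at `x₀ = 2t₀` for every `a` of the box; `hiRunWith_sound` covers a window.
-/

set_option linter.dupNamespace false

namespace Summit.RiemannHypothesis.RiemannHypothesis.Theorems

open Complex Real Finset Set MeasureTheory
open Literature.NumberTheory.LFunctions Literature.NumberTheory.LFunctions.ZetaNumerics
open Literature.Analysis.SpecialFunctions.Complex (stirlingPrim)
open Literature.Analysis.ValidatedNumerics Literature.Analysis.ValidatedNumerics.NumericsMP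

/-! ## The real part of the weighted node sum -/

/-- `Re Σ_j W_j F_κ(½ + i(T+u_j)) = Σ_j W_j e^{−2a(m − σu_j)} Re F_0(½ + i(T+u_j))` when
`−κ(T + u − t₀) = −2a(m − σu)` for all `u`. [folklore] -/
theorem UniversalFactor.hiCell_re_sum (t₀ κ a σ T m : ℝ) (hκT : ∀ u : ℝ, -κ * (T + u - t₀) = -(2 * a * (m - σ * u))) (ρD : ℕ) :
    (∑ j ∈ Finset.range 16, ((UniversalFactor.hiWt ρD j : ℝ) : ℂ) *
        UniversalFactor.lehmerF t₀ κ (1 / 2 + ((T + UniversalFactor.hiU ρD j : ℝ) : ℂ) * I)).re =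
      ∑ j ∈ Finset.range 16, UniversalFactor.hiWt ρD j * Real.exp (-(2 * a * (m - σ * UniversalFactor.hiU ρD j))) *
        (UniversalFactor.lehmerCore t₀ (1 / 2 + ((T + UniversalFactor.hiU ρD j : ℝ) : ℂ) * I)).re := by
  rw [Complex.re_sum]
  refine Finset.sum_congr rfl fun j _ => ?_
  rw [UniversalFactor.lehmerF_half t₀ κ (T + UniversalFactor.hiU ρD j), hκT]
  simp only [Complex.mul_re, Complex.ofReal_re, Complex.ofReal_im, zero_mul, sub_zero, mul_zero]
  ring

/-! ## One side -/

/-- **The core estimate of a side**: the sum of the cell integrals of `g_κ(t) = Re H_0(2t) e^{−κ(t−t₀)}`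
(`κ = ∓2a`) over the cells `T_c ∓ 1/ρD`, `c < N`, is at least `−K₀ (hi(hiSideSum)/S + hiSideErr)`.
[folklore] -/
theorem UniversalFactor.hiSide_core {C : UniversalFactor.LCtx} (hC : C.Valid) (hCt0 : C.t0 = UniversalFactor.lehmerT0)
    {ρD : ℕ} (hρ8 : 8 ≤ ρD) (fwd : Bool) {N : ℕ} (hN : 2 * N ≤ 10 * ρD + 1)
    {cells : List UniversalFactor.HiCell} (hcells : UniversalFactor.hiSideData C ρD fwd N = some cells)
    {A₁ A₂ AD : ℕ} (hAD : 0 < AD) {Ec1 Ec2 En1 En2 : List MI}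
    (hEc1 : UniversalFactor.hiExps C.T.S (UniversalFactor.hiCellArgs C.T.S A₁ AD ρD N) = some Ec1)
    (hEc2 : UniversalFactor.hiExps C.T.S (UniversalFactor.hiCellArgs C.T.S A₂ AD ρD N) = some Ec2)
    (hEn1 : UniversalFactor.hiExps C.T.S (UniversalFactor.hiNodeArgs C.T.S A₁ AD ρD fwd) = some En1)
    (hEn2 : UniversalFactor.hiExps C.T.S (UniversalFactor.hiNodeArgs C.T.S A₂ AD ρD fwd) = some En2)
    {e : ℚ} (he : UniversalFactor.hiSideErr C.T.S ρD fwd A₁ A₂ AD cells N = some e)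
    {a : ℝ} (h1 : (A₁ : ℝ) / AD ≤ a) (h2 : a ≤ (A₂ : ℝ) / AD) (κ : ℝ) (hκ : (if fwd then 2 * a else -(2 * a)) = κ) :
    -(UniversalFactor.lehmerK0 UniversalFactor.lehmerT0 *
        ((((UniversalFactor.hiSideSum C.T.S ρD cells En1 En2 Ec1 Ec2 N).hi : ℤ) : ℝ) / C.T.S + e)) ≤
      ∑ c ∈ Finset.range N, ∫ t in (UniversalFactor.hiCellT ρD fwd c - 1 / ρD)..(UniversalFactor.hiCellT ρD fwd c + 1 / ρD),
        (deBruijnH 0 ((2 * t : ℝ) : ℂ)).re * Real.exp (-κ * (t - UniversalFactor.lehmerT0)) := by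
  have hS := hC.tv.S_pos
  have hSr : (0 : ℝ) < C.T.S := by exact_mod_cast hS
  have hρ : 0 < ρD := lt_of_lt_of_le (by norm_num) hρ8
  have hρr : (0 : ℝ) < ρD := by exact_mod_cast hρ
  have hK := UniversalFactor.lehmerK0_pos UniversalFactor.lehmerT0
  have ha0 : 0 ≤ a := le_trans (by positivity) h1
  set t₀ : ℝ := UniversalFactor.lehmerT0 with ht₀def
  have ht₀ : 7000 ≤ t₀ ∧ t₀ ≤ 7010 := by
    rw [ht₀def]; unfold UniversalFactor.lehmerT0 UniversalFactor.lehmerT0N UniversalFactor.lehmerT0D; norm_num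
  set σ : ℝ := (if fwd then -1 else 1) with hσdef
  have hσ : σ = 1 ∨ σ = -1 := by rw [hσdef]; split_ifs <;> simp
  -- the node values and the data invariants
  set v : ℕ → ℕ → ℝ := fun c j =>
    (UniversalFactor.lehmerCore t₀ (1 / 2 + ((UniversalFactor.hiCellT ρD fwd c + UniversalFactor.hiU ρD j : ℝ) : ℂ) * I)).re with hv
  set D : ℕ → ℝ := fun c => (stirlingPrim (thetaArg (UniversalFactor.hiCellT ρD fwd c)) - stirlingPrim (thetaArg t₀)).re with hD
  obtain ⟨hlen, hget⟩ := UniversalFactor.hiSideData_spec C ρD fwd N hcells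
  have hcdata : ∀ c < N, (cells.getD c UniversalFactor.hiCell0).res.length = 16 ∧
      (∀ j < 16, MI.mem C.T.S (v c j) ((cells.getD c UniversalFactor.hiCell0).res.getD j ⟨0, 0⟩)) ∧
      MI.mem C.T.S (Real.log (UniversalFactor.hiCellT ρD fwd c)) (cells.getD c UniversalFactor.hiCell0).logT ∧
      MI.mem C.T.S (D c) (cells.getD c UniversalFactor.hiCell0).d0 := by
    intro c hc
    obtain ⟨h16, hnode, hlog, hd0⟩ := UniversalFactor.hiCellData_spec hC hρ (by omega) (hget c hc)
    refine ⟨h16, fun j hj => ?_, hlog, ?_⟩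
    · have := UniversalFactor.hiNodeRe_mem hC hρ (hnode j hj)
      rw [hCt0] at this; exact this
    · rw [hCt0] at hd0; exact hd0
  -- (1) the enclosure of the weighted sums
  obtain ⟨hlEc1, hmEc1⟩ := UniversalFactor.hiExps_spec hS _ hEc1
  obtain ⟨hlEc2, hmEc2⟩ := UniversalFactor.hiExps_spec hS _ hEc2
  obtain ⟨hlEn1, hmEn1⟩ := UniversalFactor.hiExps_spec hS _ hEn1
  obtain ⟨hlEn2, hmEn2⟩ := UniversalFactor.hiExps_spec hS _ hEn2
  rw [UniversalFactor.hiCellArgs_length] at hmEc1 hmEc2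
  rw [UniversalFactor.hiNodeArgs_length] at hmEn1 hmEn2
  have hsum := UniversalFactor.hiSideSum_mem hS hρ hσ h1 h2 (cells := cells) (En1 := En1) (En2 := En2) (Ec1 := Ec1) (Ec2 := Ec2) v (N := N)
    (fun c hc => hmEc1 c hc _ (UniversalFactor.hiCellArgs_mem C.T.S hρ hAD hc))
    (fun c hc => hmEc2 c hc _ (UniversalFactor.hiCellArgs_mem C.T.S hρ hAD hc))
    (fun j hj => hmEn1 j hj _ (UniversalFactor.hiNodeArgs_mem C.T.S fwd hρ hAD hj))
    (fun j hj => hmEn2 j hj _ (UniversalFactor.hiNodeArgs_mem C.T.S fwd hρ hAD hj))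
    (fun c hc j hj => (hcdata c hc).2.1 j hj) N le_rfl
  have hsum_le : ∑ c ∈ Finset.range N, ∑ j ∈ Finset.range 16,
      UniversalFactor.hiWt ρD j * Real.exp (-(2 * a * ((2 * c + 1) / ρD - σ * UniversalFactor.hiU ρD j))) * v c j ≤
      (((UniversalFactor.hiSideSum C.T.S ρD cells En1 En2 Ec1 Ec2 N).hi : ℤ) : ℝ) / C.T.S := by
    rw [le_div_iff₀ hSr]; exact hsum.2
  -- (2) the error bounds
  have herr := UniversalFactor.hiSideErr_sound hS hρ8 fwd hAD D hN (fun c hc => (hcdata c hc).2.2.1) (fun c hc => (hcdata c hc).2.2.2)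
    h1 h2 N le_rfl he
  rw [hκ] at herr
  -- (3) the cell estimates
  have hcell : ∀ c ∈ Finset.range N,
      -(UniversalFactor.lehmerK0 t₀ * (∑ j ∈ Finset.range 16,
          UniversalFactor.hiWt ρD j * Real.exp (-(2 * a * ((2 * c + 1) / ρD - σ * UniversalFactor.hiU ρD j))) * v c j)) -
        UniversalFactor.lehmerK0 t₀ *
          (UniversalFactor.lehmerMdisc t₀ κ (UniversalFactor.hiCellT ρD fwd c) (D c) *
              UniversalFactor.quadDefect (Finset.range 16) (UniversalFactor.hiU ρD) (UniversalFactor.hiWt ρD) (1 / ρD) (1 / 4) 31 +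
            2 * (1 / ρD) * (1 / 10 ^ 6) * UniversalFactor.lehmerMseg t₀ κ (UniversalFactor.hiCellT ρD fwd c) (1 / ρD) (D c)) ≤
      ∫ t in (UniversalFactor.hiCellT ρD fwd c - 1 / ρD)..(UniversalFactor.hiCellT ρD fwd c + 1 / ρD),
        (deBruijnH 0 ((2 * t : ℝ) : ℂ)).re * Real.exp (-κ * (t - t₀)) := by
    intro c hc
    rw [Finset.mem_range] at hc
    have hc10 : 2 * c + 1 ≤ 10 * ρD := by omega
    set T : ℝ := UniversalFactor.hiCellT ρD fwd c with hT
    have hTt : |T - t₀| ≤ 10 := by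
      rw [hT, UniversalFactor.hiCellT_eq hρ]
      have hle : (2 * (c : ℝ) + 1) / ρD ≤ 10 := by rw [div_le_iff₀ hρr]; exact_mod_cast hc10
      have hge : (0 : ℝ) ≤ (2 * (c : ℝ) + 1) / ρD := by positivity
      rw [← ht₀def]
      split_ifs <;> [rw [abs_le]; rw [abs_le]] <;> constructor <;> linarith
    have hκT : ∀ u : ℝ, -κ * (T + u - t₀) = -(2 * a * ((2 * c + 1) / ρD - σ * u)) := by
      intro u
      rw [hT, UniversalFactor.hiCellT_eq hρ, ← ht₀def, ← hκ, hσdef]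
      split_ifs <;> ring
    have h := UniversalFactor.stub_highCell (ι := ℕ) (Finset.range 16) (UniversalFactor.hiU ρD) (UniversalFactor.hiWt ρD) 31
      (t₀ := t₀) (κ := κ) (T := T) (ρ := 1 / ρD) (D₀ := D c) ht₀.1 ht₀.2 (by positivity)
      (one_div_le_one_div_of_le (by norm_num) (by exact_mod_cast hρ8))
      hTt (fun j _ => UniversalFactor.abs_hiU_le hρ j) le_rfl
    rw [UniversalFactor.hiCell_re_sum t₀ κ a σ T ((2 * c + 1) / ρD) hκT ρD] at h
    have := (abs_le.1 h).1
    linarith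
  -- (4) sum the cells
  have hS1 := Finset.sum_le_sum hcell
  rw [Finset.sum_sub_distrib, Finset.sum_neg_distrib, ← Finset.mul_sum, ← Finset.mul_sum] at hS1
  have hK' : 0 ≤ UniversalFactor.lehmerK0 t₀ := hK.le
  have e1 := mul_le_mul_of_nonneg_left hsum_le hK'
  have e2 := mul_le_mul_of_nonneg_left herr hK'
  linarith

/-! ## The box -/

/-- Unpacking `hCheck`: `Re F_0(½ + it₀) > 0`, hence `H_0(2t₀) < 0`. [folklore] -/
theorem UniversalFactor.hCheck_sound {C : UniversalFactor.LCtx} (hC : C.Valid) (hCt0 : C.t0 = UniversalFactor.lehmerT0)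
    (h : UniversalFactor.hCheck C = true) :
    (deBruijnH 0 ((2 * UniversalFactor.lehmerT0 : ℝ) : ℂ)).re < 0 := by
  unfold UniversalFactor.hCheck at h
  split at h
  · rename_i F hF
    simp only [decide_eq_true_eq] at h
    have hm := UniversalFactor.mem_lehmerFBox hC (by unfold UniversalFactor.lehmerT0D; norm_num)
      (by unfold UniversalFactor.lehmerT0N UniversalFactor.lehmerT0D; norm_num) hF
    rw [UniversalFactor.lehmerF_zero, hCt0] at hm
    have hre := hm.1.1
    have hlo : (0 : ℝ) < (F.re.lo : ℝ) := by exact_mod_cast h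
    have hSr : (0 : ℝ) < C.T.S := by exact_mod_cast hC.tv.S_pos
    have hpos : 0 < (UniversalFactor.lehmerCore UniversalFactor.lehmerT0
        (1 / 2 + (((UniversalFactor.lehmerT0N : ℝ) / UniversalFactor.lehmerT0D : ℝ) : ℂ) * I)).re := by
      by_contra hneg
      push Not at hneg
      nlinarith
    have e : (((UniversalFactor.lehmerT0N : ℝ) / UniversalFactor.lehmerT0D : ℝ) : ℂ) = (UniversalFactor.lehmerT0 : ℂ) := by
      unfold UniversalFactor.lehmerT0; push_cast; rfl
    rw [e] at hpos
    exact UniversalFactor.stub_highH0neg UniversalFactor.lehmerT0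
      (by unfold UniversalFactor.lehmerT0 UniversalFactor.lehmerT0N UniversalFactor.lehmerT0D; norm_num) hpos
  · simp at h

/-- **Soundness of the box check**: for every `a ∈ [A₁/AD, A₂/AD]` the dip certificate holds at
`x₀ = 2t₀`. [folklore] -/
theorem UniversalFactor.hiBoxCheck_sound {C : UniversalFactor.LCtx} (hC : C.Valid) (hCt0 : C.t0 = UniversalFactor.lehmerT0)
    {ρD CyB CyF : ℕ} {pt : UniversalFactor.HiPoint} (hpt : UniversalFactor.hiPointData C ρD CyB CyF = some pt)
    (hρ8 : 8 ≤ ρD) (hB : 2 * CyB ≤ 10 * ρD + 1) (hF : 2 * CyF ≤ 10 * ρD + 1) {A₁ A₂ AD : ℕ} (hAD : 0 < AD) (hA₁ : AD ≤ A₁)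
    (h : UniversalFactor.hiBoxCheck C pt CyB CyF A₁ A₂ AD = true) {a : ℝ} (h1 : (A₁ : ℝ) / AD ≤ a) (h2 : a ≤ (A₂ : ℝ) / AD) :
    (deBruijnH 0 ((2 * UniversalFactor.lehmerT0 : ℝ) : ℂ)).re < 0 ∧
      0 < (∫ y in Ioi (0:ℝ), deBruijnH 0 (((2 * UniversalFactor.lehmerT0 : ℝ) : ℂ) - y) * (Real.exp (-(a * y)) : ℂ)).re ∧
      0 < (∫ y in Ioi (0:ℝ), deBruijnH 0 (((2 * UniversalFactor.lehmerT0 : ℝ) : ℂ) + y) * (Real.exp (-(a * y)) : ℂ)).re := by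
  have hS := hC.tv.S_pos
  have hSr : (0 : ℝ) < C.T.S := by exact_mod_cast hS
  have hρ : 0 < ρD := lt_of_lt_of_le (by norm_num) hρ8
  have hρr : (0 : ℝ) < ρD := by exact_mod_cast hρ
  have hADr : (0 : ℝ) < AD := by exact_mod_cast hAD
  have ha₁ : (1 : ℝ) ≤ (A₁ : ℝ) / AD := by rw [le_div_iff₀ hADr, one_mul]; exact_mod_cast hA₁
  have ha1 : 1 ≤ a := ha₁.trans h1
  have ha0 : 0 < a := by linarith
  have hK := UniversalFactor.lehmerK0_pos UniversalFactor.lehmerT0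
  set t₀ : ℝ := UniversalFactor.lehmerT0 with ht₀def
  have ht₀ : 7000 ≤ t₀ ∧ t₀ ≤ 7010 := by
    rw [ht₀def]; unfold UniversalFactor.lehmerT0 UniversalFactor.lehmerT0N UniversalFactor.lehmerT0D; norm_num
  obtain ⟨hptρ, hbwd, hfwd, hh0⟩ := UniversalFactor.hiPointData_spec hpt
  unfold UniversalFactor.hiBoxCheck at h
  simp only at h
  split at h
  · rename_i EcB1 EcB2 EnB1 EnB2 EcF1 EcF2 EnF1 EnF2 eP eQ tP tQ htabs heP heQ htails
    simp only [Bool.and_eq_true, decide_eq_true_eq] at h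
    obtain ⟨⟨hP, hQ⟩, hh⟩ := h
    rw [hptρ] at htabs heP heQ htails hP hQ
    -- the weight tables
    unfold UniversalFactor.hiBoxTabs at htabs
    split at htabs
    · rename_i EcB1' EcB2' EnB1' EnB2' hEcB1 hEcB2 hEnB1 hEnB2
      split at htabs
      · rename_i EcF1' EcF2' EnF1' EnF2' hEcF1 hEcF2 hEnF1 hEnF2
        simp only [Option.some.injEq, Prod.mk.injEq] at htabs
        obtain ⟨⟨rfl, rfl, rfl, rfl⟩, ⟨rfl, rfl, rfl, rfl⟩⟩ := htabs
        obtain ⟨htP, htQ⟩ := UniversalFactor.hiTails_sound hC hρ hAD hA₁ htails h1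
        refine ⟨?_, ?_, ?_⟩
        · -- the sign of `H_0(2t₀)`
          rw [hh0] at hh
          exact UniversalFactor.hCheck_sound hC hCt0 hh
        · -- `P > 0`
          have hcore := UniversalFactor.hiSide_core hC hCt0 hρ8 false hB hbwd hAD hEcB1 hEcB2 hEnB1 hEnB2 heP h1 h2 (-(2 * a)) rfl
          have hdec := UniversalFactor.stub_highSideP t₀ a (1 / ρD) CyB ha0 (by positivity)
          have hcells : ∀ c : ℕ, t₀ - (2 * c + 1) * (1 / ρD) = UniversalFactor.hiCellT ρD false c := by
            intro c; rw [UniversalFactor.hiCellT_eq hρ, ← ht₀def]; simp; ring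
          simp only [hcells] at hdec
          have htail := UniversalFactor.stub_highTailP t₀ a (4 * (1 / ρD) * CyB) ht₀.1 ha1 (by positivity)
            (by
              have : (4 * (1 / (ρD : ℝ)) * CyB) ≤ 4 * ((10 * ρD + 1) / 2) / ρD := by
                rw [mul_comm 4 (1 / (ρD:ℝ)), mul_assoc, one_div_mul_eq_div]
                apply div_le_div_of_nonneg_right _ hρr.le
                have : (2 * (CyB : ℝ)) ≤ 10 * ρD + 1 := by exact_mod_cast hB
                linarith
              have h8 : (8 : ℝ) ≤ ρD := by exact_mod_cast hρ8
              have : 4 * ((10 * (ρD : ℝ) + 1) / 2) / ρD ≤ 21 := by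
                rw [div_le_iff₀ hρr]; nlinarith
              linarith [ht₀.1])
          have hre : |(∫ y in Ioi (4 * (1 / (ρD : ℝ)) * CyB),
              deBruijnH 0 (((2 * t₀ : ℝ) : ℂ) - y) * (Real.exp (-(a * y)) : ℂ)).re| ≤
              UniversalFactor.lehmerK0 t₀ * (tP : ℝ) := by
            refine (Complex.abs_re_le_norm _).trans ((norm_integral_le_integral_norm _).trans (htail.trans ?_))
            refine mul_le_mul_of_nonneg_left ?_ hK.le
            have e : (a - Real.pi / 8) * (4 * (1 / (ρD : ℝ)) * CyB) = (a - Real.pi / 8) * (4 * CyB / ρD) := by ring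
            rw [e]; exact htP
          have hre' := (abs_le.1 hre).1
          rw [hdec]
          have hP' : (((UniversalFactor.hiSideSum C.T.S ρD pt.bwd EnB1' EnB2' EcB1' EcB2' CyB).hi : ℤ) : ℝ) / C.T.S + eP + tP / 2 < 0 := by
            exact_mod_cast hP
          nlinarith
        · -- `Q > 0`
          have hcore := UniversalFactor.hiSide_core hC hCt0 hρ8 true hF hfwd hAD hEcF1 hEcF2 hEnF1 hEnF2 heQ h1 h2 (2 * a) rfl
          have hdec := UniversalFactor.stub_highSideQ t₀ a (1 / ρD) CyF ha0 (by positivity)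
          have hcells : ∀ c : ℕ, t₀ + (2 * c + 1) * (1 / ρD) = UniversalFactor.hiCellT ρD true c := by
            intro c; rw [UniversalFactor.hiCellT_eq hρ, ← ht₀def]; simp; ring
          simp only [hcells] at hdec
          have htail := UniversalFactor.stub_highTailQ t₀ a (4 * (1 / ρD) * CyF) (by linarith [ht₀.1]) ha1 (by positivity)
          have hre : |(∫ y in Ioi (4 * (1 / (ρD : ℝ)) * CyF),
              deBruijnH 0 (((2 * t₀ : ℝ) : ℂ) + y) * (Real.exp (-(a * y)) : ℂ)).re| ≤
              UniversalFactor.lehmerK0 t₀ * (tQ : ℝ) := by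
            refine (Complex.abs_re_le_norm _).trans ((norm_integral_le_integral_norm _).trans (htail.trans ?_))
            refine mul_le_mul_of_nonneg_left ?_ hK.le
            have e : a * (4 * (1 / (ρD : ℝ)) * CyF) = a * (4 * CyF / ρD) := by ring
            rw [e]; exact htQ
          have hre' := (abs_le.1 hre).1
          rw [hdec]
          have hQ' : (((UniversalFactor.hiSideSum C.T.S ρD pt.fwd EnF1' EnF2' EcF1' EcF2' CyF).hi : ℤ) : ℝ) / C.T.S + eQ + tQ / 2 < 0 := by
            exact_mod_cast hQ
          nlinarith
      · simp at htabs
    · simp at htabs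
  · simp at h

/-! ## The cover and the window -/

/-- **Soundness of the window check**: a passing `hiRunWith` on valid tables gives the dip certificate at
`x₀ = 2t₀` for every `a` of the window `[As₀/AD, As_last/AD]`. [folklore] -/
theorem UniversalFactor.hiRunWith_sound {oT : Option Tables} (hT : ∀ T, oT = some T → T.Valid)
    {ρD CyB CyF : ℕ} {As : List ℕ} {AD : ℕ} (h : UniversalFactor.hiRunWith oT ρD CyB CyF As AD = true)
    {a : ℝ} (hlo : (As.getD 0 0 : ℝ) / AD ≤ a) (hhi : a ≤ (As.getD (As.length - 1) 0 : ℝ) / AD) :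
    (deBruijnH 0 ((2 * UniversalFactor.lehmerT0 : ℝ) : ℂ)).re < 0 ∧
      0 < (∫ y in Ioi (0:ℝ), deBruijnH 0 (((2 * UniversalFactor.lehmerT0 : ℝ) : ℂ) - y) * (Real.exp (-(a * y)) : ℂ)).re ∧
      0 < (∫ y in Ioi (0:ℝ), deBruijnH 0 (((2 * UniversalFactor.lehmerT0 : ℝ) : ℂ) + y) * (Real.exp (-(a * y)) : ℂ)).re := by
  cases oT with
  | none => simp [UniversalFactor.hiRunWith] at h
  | some T =>
    have hTv : T.Valid := hT T rfl
    unfold UniversalFactor.hiRunWith at h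
    dsimp only at h
    split at h
    · simp at h
    · rename_i C hC
      obtain ⟨hCT, -, hN, hD⟩ := UniversalFactor.mkCtx_fields hC
      obtain ⟨h1, h2, h3, h4, h5, h6, h7⟩ := UniversalFactor.mkCtx_spec hTv hC
      have hCv : C.Valid := ⟨h1, h2, h3, h4, h5, h6, h7⟩
      have hCt0 : C.t0 = UniversalFactor.lehmerT0 := UniversalFactor.LCtx.t0_eq hN hD
      split at h
      · simp at h
      · rename_i pt hpt
        unfold UniversalFactor.hiCoverCheck at h
        simp only [Bool.and_eq_true, decide_eq_true_eq, List.all_eq_true, List.mem_range] at h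
        obtain ⟨⟨hρ8, hB, hF, hAD, hlen⟩, hall⟩ := h
        have hptρ := (UniversalFactor.hiPointData_spec hpt).1
        rw [hptρ] at hρ8 hB hF
        obtain ⟨k, hk, hk1, hk2⟩ := UniversalFactor.osa_cover_find As AD a hlo (As.length - 1) (by omega) hhi
        obtain ⟨hA₁, hbox⟩ := hall k hk
        exact UniversalFactor.hiBoxCheck_sound hCv hCt0 hpt hρ8 hB hF hAD hA₁ hbox hk1 hk2

/-- **Registered anchor `stub_hiCheckSound`** of this file (`hCheck ⇒ H_0(2t₀) < 0`). [folklore] -/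
theorem UniversalFactor.stub_hiCheckSound :
    ∀ {C : UniversalFactor.LCtx}, C.Valid → C.t0 = UniversalFactor.lehmerT0 → UniversalFactor.hCheck C = true → (deBruijnH 0 ((2 * UniversalFactor.lehmerT0 : ℝ) : ℂ)).re < 0 :=
  fun hC hCt0 h => UniversalFactor.hCheck_sound hC hCt0 h

end Summit.RiemannHypothesis.RiemannHypothesis.Theorems
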